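import Summits.ResolutionOfSingularities.ResolutionOfSingularities.Theorems.FrobeniusClosingPatchingRelPerfectDepthPhaseCOnePieces
import HarnessLib

/-!
# Crux `PatchingRelPerfect` (stmt-ResolutionOfSingularities-16161), chain W5.2 — F7(β) (β-AX) X3 C-I (A′): THE CURE ADAPTER — a cure stated
# on the OPENS of `X` (the shape of `X3LemmaM.ContactCure₃Pw`) yields the cure on every Noetherian scheme open-immersed in `X` (the shape the
# pieces bridge `goodEnd_of_closedPieces` asks)

[OURS · L1 W5.2 · RECORD R13-1 (3) (hand res-L1-w52-lead-1 g6).]  Replaces the role of NO printed item; NOT a statement of the manuscript under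
review (AI-written; AI review weaker than expert review; counted 0).  Def-free.  Restriction of the cure along the isomorphism
`Scheme.Hom.isoOpensRange : Y ≅ g.opensRange` (`CentreSeq.restrict`, `AllRegular.restrict`, `CentresOver.restrict`, `isOpenImmersion_restrictι`,
`restrict_comp`) and PULL of local END along the open immersion `restrictι` (…DepthPhaseCEndNearTransport).

## References
* E. Bierstone, D. Grigoriev, P. Milman, J. Włodarczyk, arXiv:1206.3090, Thm. 8.0.5 (2), Def. 3.1.5 Remark (1). [BierstoneGrigorievMilmanWlodarczyk2011]
-/

-- `Summit.<Summit>.<Sub>.Theorems` with `Sub = Summit` (single-conjunct summit, D-0017)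
set_option linter.dupNamespace false

noncomputable section

namespace Summit.ResolutionOfSingularities.ResolutionOfSingularities.Theorems.X3LemmaM

open CategoryTheory AlgebraicGeometry TopologicalSpace IsLocalRing
open Literature.AlgebraicGeometry.Resolution
open Scheme.IdealSheafData

universe u

/-- [OURS · L1 W5.2 · X3 C-I (A′)] **THE CURE ADAPTER.**  If for every open `U ⊇ P i` of `X` missing the other pieces there is a blow-up sequence
of `U` with regular centres over `P i`, regular top and local END of the total transform of `K|_U` at the points over `P i`, then the same holds
on every Noetherian `Y` with an open immersion `g : Y ⟶ X` whose range contains `P i` and misses the other pieces — the `hcure` binder of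
`goodEnd_of_closedPieces`. [cite: BierstoneGrigorievMilmanWlodarczyk2011, Thm. 8.0.5 (2)] -/
theorem hcure_of_opensCure {X : Scheme.{u}} [IsNoetherian X] (K : X.IdealSheafData) {n : ℕ} (P : Fin n → Closeds X) (i : Fin n)
    (h : ∀ U : X.Opens, (P i : Set X) ⊆ (U : Set X) → (∀ k, k ≠ i → Disjoint (U : Set X) (P k)) →
      ∃ s : CentreSeq (U : Scheme.{u}), s.AllRegular ∧ s.CentresOver (U.ι.base ⁻¹' (P i : Set X)) ∧ Scheme.IsRegular s.top ∧
        ∃ 𝓛' : List s.top.IdealSheafData, ∀ x' ∈ (((K.comap U.ι).comap s.comp).support : Set s.top),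
          s.comp.base x' ∈ U.ι.base ⁻¹' (P i : Set X) → IsEndNear ((K.comap U.ι).comap s.comp) 𝓛' x')
    (Y : Scheme.{u}) (g : Y ⟶ X) [IsOpenImmersion g] (hP : (P i : Set X) ⊆ Set.range g.base)
    (hk : ∀ k, k ≠ i → Disjoint (Set.range g.base) (P k)) :
    ∃ s : CentreSeq Y, s.AllRegular ∧ s.CentresOver (g.base ⁻¹' (P i)) ∧ Scheme.IsRegular s.top ∧
      ∃ 𝓛' : List s.top.IdealSheafData, ∀ y ∈ (((K.comap g).comap s.comp).support : Set s.top),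
        g.base (s.comp.base y) ∈ (P i : Set X) → IsEndNear ((K.comap g).comap s.comp) 𝓛' y := by
  haveI : IsLocallyNoetherian Y := isLocallyNoetherian_of_isOpenImmersion g
  have hU : ((g.opensRange : X.Opens) : Set X) = Set.range g.base := rfl
  obtain ⟨s, hreg, hover, htop, 𝓛', hend⟩ := h g.opensRange (by rw [hU]; exact hP) (fun k hki => by rw [hU]; exact hk k hki)
  set e := g.isoOpensRange with he
  have hfac : e.hom ≫ g.opensRange.ι = g := Scheme.Hom.isoOpensRange_hom_ι g
  haveI hι : IsOpenImmersion (s.restrictι e.hom) := CentreSeq.isOpenImmersion_restrictι s e.hom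
  haveI : CompactSpace (g.opensRange : Scheme.{u}) :=
    isCompact_iff_compactSpace.mp (TopologicalSpace.NoetherianSpace.isCompact ((g.opensRange : X.Opens) : Set X))
  haveI : IsNoetherian (g.opensRange : Scheme.{u}) := ⟨⟩
  haveI : IsNoetherian s.top := CentreSeq.isNoetherian_top s
  have hcomp : (s.restrict e.hom).comp ≫ g = s.restrictι e.hom ≫ s.comp ≫ g.opensRange.ι := by
    have h0 : (s.restrict e.hom).comp ≫ (e.hom ≫ g.opensRange.ι) = s.restrictι e.hom ≫ s.comp ≫ g.opensRange.ι := by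
      rw [← Category.assoc, CentreSeq.restrict_comp, Category.assoc]
    rwa [hfac] at h0
  have hK : (K.comap g).comap (s.restrict e.hom).comp = ((K.comap g.opensRange.ι).comap s.comp).comap (s.restrictι e.hom) := by
    rw [← Scheme.IdealSheafData.comap_comp, ← Scheme.IdealSheafData.comap_comp, ← Scheme.IdealSheafData.comap_comp, hcomp]
    simp only [Category.assoc]
  refine ⟨s.restrict e.hom, CentreSeq.AllRegular.restrict s e.hom hreg, ?_,
    Scheme.IsRegular.of_isOpenImmersion (s.restrictι e.hom) htop, 𝓛'.map (·.comap (s.restrictι e.hom)), fun y hy hyP => ?_⟩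
  · have h1 := CentreSeq.CentresOver.restrict s e.hom hover
    have hset : e.hom.base ⁻¹' (g.opensRange.ι.base ⁻¹' (P i : Set X)) = g.base ⁻¹' (P i : Set X) := by
      rw [← Set.preimage_comp, ← TopCat.coe_comp, ← Scheme.Hom.comp_base, hfac]
    rwa [hset] at h1
  · rw [hK] at hy ⊢
    have hx' : (s.restrictι e.hom).base y ∈ ((((K.comap g.opensRange.ι).comap s.comp)).support : Set s.top) :=
      (mem_support_comap_iff _ _ y).mp hy
    have hpt : g.base ((s.restrict e.hom).comp.base y) = g.opensRange.ι.base (s.comp.base ((s.restrictι e.hom).base y)) := by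
      have := congrArg (fun f : (s.restrict e.hom).top ⟶ X => f.base y) hcomp
      simpa only [Scheme.Hom.comp_base, TopCat.coe_comp, Function.comp_apply] using this
    have hxP : s.comp.base ((s.restrictι e.hom).base y) ∈ g.opensRange.ι.base ⁻¹' (P i : Set X) := by
      show g.opensRange.ι.base _ ∈ (P i : Set X)
      rw [← hpt]; exact hyP
    exact (hend _ hx' hxP).comap_of_isOpenImmersion (s.restrictι e.hom)

end Summit.ResolutionOfSingularities.ResolutionOfSingularities.Theorems.X3LemmaM

end
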